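import Literature.InformationTheory.Coding.TensorProductCodes

/-!
# The dimension of a tensor product code: `dim (C₁ ⊗ C₂) = dim C₁ · dim C₂`

For linear codes `C₁ ≤ F^m`, `C₂ ≤ F^n` over a field, the tensor product code
`C₁ ⊗ C₂ = {M : Matrix m n F | every column ∈ C₁, every row ∈ C₂}`
(`Literature.InformationTheory.Coding.TensorCode.tensorCode`) has dimension `dim C₁ · dim C₂`.
PROVED here (elementary): writing each row of `M` in a basis `(b_t)` of `C₂`, `M = ∑_t A_t ⊗ b_t` with
uniquely determined coefficient columns `A_t`; each `A_t` is a linear combination of columns of `M`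
(the coordinate functional extends to `F^n`), hence lies in `C₁`; so `C₁ ⊗ C₂ ≃ C₁^{dim C₂}`.
This is the dimension count used by Tillich–Zémor for the chamber code of a hypergraph product
("a vector space isomorphic to the product code `Z(ℋ₁) ⊗ Z(ℋ₂)`, and its dimension is therefore `kh`",
arXiv:0903.0566v1 Prop. 5) [TillichZemor2014].
-/

namespace Literature.InformationTheory.Coding.TensorCode

open Matrix Module

variable {F : Type*} [Field F]
variable {m n : Type*} [Fintype m] [Fintype n] [DecidableEq n]

omit [Fintype m] in
/-- Applying a linear functional `ψ : F^n → F` to every row of a word whose columns lie in `C₁` gives a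
vector of `C₁` (it is the combination `∑ⱼ ψ(eⱼ) · (column j)`). [folklore] -/
private theorem rowFunctional_mem {C₁ : Submodule F (m → F)} (ψ : (n → F) →ₗ[F] F) {M : Matrix m n F}
    (hM : ∀ j, Mᵀ j ∈ C₁) : (fun i => ψ (M i)) ∈ C₁ := by
  have h : (fun i => ψ (M i)) = ∑ j, ψ (fun k => if j = k then 1 else 0) • Mᵀ j := by
    ext i
    rw [LinearMap.pi_apply_eq_sum_univ ψ (M i), Finset.sum_apply]
    exact Finset.sum_congr rfl fun j _ => by simp [mul_comm]
  rw [h]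
  exact C₁.sum_mem fun j _ => C₁.smul_mem _ (hM j)

/-- **`dim (C₁ ⊗ C₂) = dim C₁ · dim C₂`** for linear codes over a field.
[cite: TillichZemor2014, proof of Prop. 5 (arXiv v1 chunk p0007 L96-101)] -/
theorem finrank_tensorCode (C₁ : Submodule F (m → F)) (C₂ : Submodule F (n → F)) :
    finrank F (tensorCode C₁ C₂) = finrank F C₁ * finrank F C₂ := by
  classical
  -- a basis of `C₂` and a left inverse of the inclusion `C₂ ↪ F^n`
  set h := finrank F C₂
  let b : Basis (Fin h) F C₂ := Module.finBasis F C₂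
  obtain ⟨π, hπ⟩ := C₂.subtype.exists_leftInverse_of_injective (Submodule.ker_subtype C₂)
  have hπ' : ∀ x : C₂, π (x : n → F) = x := fun x => by
    simpa using LinearMap.congr_fun hπ x
  -- coordinate functionals on all of `F^n`
  let ψ : Fin h → ((n → F) →ₗ[F] F) := fun t => (b.coord t).comp π
  have hψ : ∀ t (x : C₂), ψ t (x : n → F) = b.repr x t := fun t x => by
    simp [ψ, hπ' x]
  -- the coefficient isomorphism `C₁ ⊗ C₂ ≃ (Fin h → C₁)`
  let e : tensorCode C₁ C₂ ≃ₗ[F] (Fin h → C₁) :=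
    { toFun := fun M t => ⟨fun i => ψ t (M.1 i), rowFunctional_mem (ψ t) (mem_tensorCode_iff.1 M.2).1⟩
      map_add' := fun M N => by
        ext t i
        change ψ t (M.1 i + N.1 i) = ψ t (M.1 i) + ψ t (N.1 i)
        rw [map_add]
      map_smul' := fun c M => by
        ext t i
        change ψ t (c • M.1 i) = c * ψ t (M.1 i)
        rw [map_smul, smul_eq_mul]
      invFun := fun A => ⟨Matrix.of fun i j => ∑ t, (A t : m → F) i * (b t : n → F) j, by
        refine mem_tensorCode_iff.2 ⟨fun j => ?_, fun i => ?_⟩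
        · have : (Matrix.of fun i j => ∑ t, (A t : m → F) i * (b t : n → F) j)ᵀ j
              = ∑ t, (b t : n → F) j • (A t : m → F) := by
            ext i; simp [Finset.sum_apply, mul_comm]
          rw [this]
          exact C₁.sum_mem fun t _ => C₁.smul_mem _ (A t).2
        · have : (Matrix.of fun i j => ∑ t, (A t : m → F) i * (b t : n → F) j) i
              = ∑ t, (A t : m → F) i • (b t : n → F) := by
            ext j; simp [Finset.sum_apply]
          rw [this]
          exact C₂.sum_mem fun t _ => C₂.smul_mem _ (b t).2⟩
      left_inv := fun M => by
        obtain ⟨M, hM⟩ := M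
        have hrows := (mem_tensorCode_iff.1 hM).2
        apply Subtype.ext
        ext i j
        simp only [Matrix.of_apply]
        have hx : ∀ t, ψ t (M i) = b.repr ⟨M i, hrows i⟩ t := fun t => hψ t ⟨M i, hrows i⟩
        simp_rw [hx]
        have hs := congrArg (fun x : C₂ => (x : n → F) j) (b.sum_repr ⟨M i, hrows i⟩)
        simp only [Submodule.coe_sum, Submodule.coe_smul, Finset.sum_apply, Pi.smul_apply,
          smul_eq_mul] at hs
        exact hs
      right_inv := fun A => by
        ext t i
        change ψ t (fun j => ∑ s, (A s : m → F) i * (b s : n → F) j) = (A t : m → F) i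
        have hrow : (fun j => ∑ s, (A s : m → F) i * (b s : n → F) j)
            = ((∑ s, (A s : m → F) i • b s : C₂) : n → F) := by
          ext j; simp [Finset.sum_apply]
        rw [hrow, hψ, b.repr_sum_self] }
  rw [LinearEquiv.finrank_eq e, Module.finrank_pi_fintype, Finset.sum_const, Finset.card_univ,
    Fintype.card_fin, smul_eq_mul, mul_comm]

end Literature.InformationTheory.Coding.TensorCode
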